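import Mathlib
import Summits.NavierStokesRegularity.OSWSelfSimilar.SheetNSLineTorusCascadeLinkModes
import Summits.NavierStokesRegularity.OSWSelfSimilar.SheetNSLineTorusCascadeExistence
import HarnessLib

/-!
# Viscous CLM on the torus (`a = 0`, `σ = 2`): THE PDE ↔ CASCADE LINK, part 2 — every classical periodic solution
# from `ω₀ = −c sin x` has window modes obeying the sine cascade (C); hence NO CLASSICAL SOLUTION SURVIVES TO
# `t = log 2/ν` WHEN `c ≥ 48ν`

HONEST FRAMING (cell ns-blowup GROUP B «PROFILE SEARCH», zone Z3, row Z3-U addendum A-F2 of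
`HOME/profile/z3/CENSUS-Z3.md`; human rulings D-0035/D-0074): **1-D MODEL — the viscous Constantin–Lax–Majda
equation `ω_t = ω·Hω + ν ω_xx` on `𝕋` with `H = hilbertTransformCircle`; not Euler, not Navier–Stokes; «violates:
none — MODEL».** Sequel of `SheetNSLineTorusCascadeLinkModes` (solution class `IsClassicalSolution`, window modes
`mode`, cascade variable `coef = −(i/π)·mode`, multiplier on slices, sgn-pairing of `ω·Hω`).

THE LINK (for the datum `ω(0,·) = −c sin`):
* `mode_datum`, `coef_one_zero` (`c_1(0) = c`), `mode_zero_zero`, `coef_zero_of_two_le` — the sine datum;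
* `mode_zero_eq_zero` — **mean zero is propagated** (`(ω·Hω)^(0) = 0` by the pairing; zero derivative on `(0,T)`,
  continuity on `[0,T]`);
* `hasDerivAt_coef` — **the complex cascade** `d/dt c_k = ½ Σ_{i+j=k} c_i c_j − ν k² c_k` on `(0,T)`;
* `coef_im_eq_zero` — **the modes stay purely «sine»** (`Im c_k ≡ 0`, strong induction on the triangular structure:
  `Im(e^{νk²t} c_k)` has zero derivative) — the solution stays odd;
* `isSineCascadeOn_coef_re` — **`k ↦ Re c_k` is an `IsSineCascadeOn ν c T`** (the finite-horizon structure of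
  `SheetNSLineTorusCascadeExtend`, p509039); `exists_abs_coef_re_le` — `|Re c_k(t)|` bounded uniformly in `k`.

THE THEOREMS.
* **`horizon_lt_log_two_div`** — `0 < ν`, `48ν ≤ c`: every classical solution on `[0,T]` from `−c sin x` has
  `T < log 2/ν` (via `IsSineCascadeOn.unbounded_of_le`, i.e. `unbounded_of_le` of p498092 through the canonical
  extension): **no classical solution of the periodic viscous CLM from large sine data survives to `t = log 2/ν` —
  finite-time loss of classical regularity ON THE MODEL, kernel-checked** (the periodic `σ = 2` case reported open in
  [cite: SilantyevLushnikovSiegelAmbrose2025, §6 p. 25 (arXiv:2411.01891)]);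
* **`horizon_lt_of_cascade_unbounded`** — the transfer form: if EVERY global sine cascade with datum `c` is unbounded
  in `k` at some time `τ > 0`, then every classical solution from `−c sin x` has `T < τ` (the slot for the certified
  constants: `tail_induction` + kit certificates, eng-5's Theorem B).

bears_on: LADDER-NS N5 / zone Z3 (row Z3-U, A-F2; clause (i′) divide) → N1 linear core. WHAT THIS IS NOT: not NS; no
EXISTENCE statement (local well-posedness of the model is print, [cite: AmbroseLushnikovSiegelSilantyev2024, §3
(arXiv:2207.07548)]); «blow-up» here means exactly: no classical solution in the above sense exists on `[0, log 2/ν]`.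
-/

noncomputable section

namespace Summit.NavierStokesRegularity.OSWSelfSimilar
namespace SheetNSLineTorusCascade

open Finset Real Set Filter MeasureTheory intervalIntegral Complex
open Literature.Analysis.Fourier
open scoped Topology

variable {ν T : ℝ} {ω ωt ωx ωxx : ℝ → ℝ → ℝ}

/-! ### Calculus helpers -/

/-- A real function continuous on `[a, b]` with zero derivative on `(a, b)` is constant on `[a, b]`. [folklore] -/
private theorem eq_of_hasDerivAt_zero {φ : ℝ → ℝ} {a b : ℝ} (hc : ContinuousOn φ (Icc a b))
    (hd : ∀ t ∈ Ioo a b, HasDerivAt φ 0 t) {t : ℝ} (ht : t ∈ Icc a b) : φ t = φ a := by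
  have hab : a ≤ b := ht.1.trans ht.2
  have hmono : MonotoneOn φ (Icc a b) :=
    monotoneOn_of_hasDerivWithinAt_nonneg (f' := fun _ => 0) (convex_Icc a b) hc
      (by rw [interior_Icc]; exact fun x hx => (hd x hx).hasDerivWithinAt) (by intros; exact le_rfl)
  have hanti : AntitoneOn φ (Icc a b) :=
    antitoneOn_of_hasDerivWithinAt_nonpos (f' := fun _ => 0) (convex_Icc a b) hc
      (by rw [interior_Icc]; exact fun x hx => (hd x hx).hasDerivWithinAt) (by intros; exact le_rfl)
  have ha : a ∈ Icc a b := left_mem_Icc.2 hab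
  exact le_antisymm (hanti ha ht ht.1) (hmono ha ht ht.1)

/-- The imaginary part of a complex function with derivative `D` has derivative `D.im`. [folklore] -/
private theorem hasDerivAt_im {ψ : ℝ → ℂ} {D : ℂ} {t : ℝ} (hψ : HasDerivAt ψ D t) :
    HasDerivAt (fun s => (ψ s).im) D.im t := by
  rw [show (fun s => (ψ s).im) = Complex.imCLM ∘ ψ from rfl]
  exact (Complex.imCLM.hasFDerivAt.comp_hasDerivAt t hψ).congr_deriv (by simp)

/-- The real part of a complex function with derivative `D` has derivative `D.re`. [folklore] -/
private theorem hasDerivAt_re {ψ : ℝ → ℂ} {D : ℂ} {t : ℝ} (hψ : HasDerivAt ψ D t) :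
    HasDerivAt (fun s => (ψ s).re) D.re t := by
  rw [show (fun s => (ψ s).re) = Complex.reCLM ∘ ψ from rfl]
  exact (Complex.reCLM.hasFDerivAt.comp_hasDerivAt t hψ).congr_deriv (by simp)

/-- `∫₀^{2π} e_n(x) dx = 2π·[n = 0]` for the characters of the circle of length `2π`. [folklore] -/
private theorem integral_fourier_two_pi (n : ℤ) :
    (∫ x in (0 : ℝ)..2 * π, fourier n (x : AddCircle (2 * π))) = if n = 0 then ((2 * π : ℝ) : ℂ) else 0 := by
  split_ifs with hn
  · subst hn
    simp
  · have hc : Continuous fun x : ℝ => fourier n (x : AddCircle (2 * π)) :=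
      (map_continuous (fourier n)).comp (AddCircle.continuous_mk' (2 * π))
    set C : ℂ := 2 * π * I * n / ((2 * π : ℝ) : ℂ) with hC
    have hC0 : C ≠ 0 := by
      have hπ : (π : ℂ) ≠ 0 := by exact_mod_cast Real.pi_ne_zero
      have hn' : (n : ℂ) ≠ 0 := by exact_mod_cast hn
      have hC' : C = I * n := by rw [hC]; push_cast; field_simp
      rw [hC']
      exact mul_ne_zero I_ne_zero hn'
    have hderiv : ∀ x ∈ uIcc (0 : ℝ) (2 * π),
        HasDerivAt (fun y : ℝ => fourier n (y : AddCircle (2 * π))) (C * fourier n (x : AddCircle (2 * π))) x :=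
      fun x _ => hasDerivAt_fourier (2 * π) n x
    have hftc := intervalIntegral.integral_eq_sub_of_hasDerivAt hderiv ((hc.const_mul C).intervalIntegrable _ _)
    rw [intervalIntegral.integral_const_mul, fourier_coe_period, sub_self] at hftc
    exact (mul_eq_zero.mp hftc).resolve_left hC0

/-! ### The datum `ω₀ = −c sin x` -/

section datum

variable {c : ℝ} (hω0 : ∀ x, ω 0 x = -c * Real.sin x)
include hω0

/-- The modes of the datum: `mode ω n 0 = (ic/2)·(∫ e_{1−n} − ∫ e_{−1−n})`. [new here — MODEL] -/
theorem mode_datum (n : ℤ) :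
    mode ω n 0 = (I * c / 2) * ((if 1 - n = 0 then ((2 * π : ℝ) : ℂ) else 0)
      - (if -1 - n = 0 then ((2 * π : ℝ) : ℂ) else 0)) := by
  unfold mode modeCoeff
  have hsin : ∀ x : ℝ, ((-c * Real.sin x : ℝ) : ℂ)
      = (I * c / 2) * (fourier 1 (x : AddCircle (2 * π)) - fourier (-1) (x : AddCircle (2 * π))) := by
    intro x
    have hπ : (π : ℂ) ≠ 0 := by exact_mod_cast Real.pi_ne_zero
    rw [fourier_coe_apply, fourier_coe_apply, Complex.ofReal_mul, Complex.ofReal_sin, Complex.sin]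
    have e1 : 2 * π * I * ((1 : ℤ) : ℂ) * (x : ℂ) / ((2 * π : ℝ) : ℂ) = x * I := by push_cast; field_simp
    have e2 : 2 * π * I * ((-1 : ℤ) : ℂ) * (x : ℂ) / ((2 * π : ℝ) : ℂ) = -x * I := by push_cast; field_simp
    rw [e1, e2]
    push_cast
    ring
  have hint : ∀ x : ℝ, fourier (-n) (x : AddCircle (2 * π)) * ((ω 0 x : ℝ) : ℂ)
      = (I * c / 2) * (fourier (1 - n) (x : AddCircle (2 * π)) - fourier (-1 - n) (x : AddCircle (2 * π))) := by
    intro x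
    rw [hω0 x, hsin x, show (1 : ℤ) - n = -n + 1 by ring, show (-1 : ℤ) - n = -n + (-1) by ring,
      fourier_add, fourier_add]
    ring
  simp_rw [hint]
  have hc1 : Continuous fun x : ℝ => fourier (1 - n) (x : AddCircle (2 * π)) :=
    (map_continuous (fourier (1 - n))).comp (AddCircle.continuous_mk' (2 * π))
  have hc2 : Continuous fun x : ℝ => fourier (-1 - n) (x : AddCircle (2 * π)) :=
    (map_continuous (fourier (-1 - n))).comp (AddCircle.continuous_mk' (2 * π))
  rw [intervalIntegral.integral_const_mul, intervalIntegral.integral_sub (hc1.intervalIntegrable _ _)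
    (hc2.intervalIntegrable _ _), integral_fourier_two_pi, integral_fourier_two_pi]

/-- `coef ω 1 0 = c`. [new here — MODEL] -/
theorem coef_one_zero : coef ω 1 0 = c := by
  rw [coef, Nat.cast_one, mode_datum hω0]
  have hπ : (π : ℂ) ≠ 0 := by exact_mod_cast Real.pi_ne_zero
  simp only [sub_self, if_true, show (-1 : ℤ) - 1 ≠ 0 by norm_num, if_false, sub_zero]
  push_cast
  field_simp
  rw [Complex.I_sq]
  ring

/-- `mode ω 0 0 = 0` (the datum has mean zero). [new here — MODEL] -/
theorem mode_zero_zero : mode ω 0 0 = 0 := by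
  rw [mode_datum hω0]
  simp

/-- `coef ω k 0 = 0` for `k ≥ 2`. [new here — MODEL] -/
theorem coef_zero_of_two_le {k : ℕ} (hk : 2 ≤ k) : coef ω k 0 = 0 := by
  rw [coef, mode_datum hω0]
  have h1 : (1 : ℤ) - (k : ℤ) ≠ 0 := by omega
  have h2 : (-1 : ℤ) - (k : ℤ) ≠ 0 := by omega
  simp [h1, h2]

end datum
/-! ### The cascade for the modes -/

section cascade

variable (h : IsClassicalSolution ν T ω ωt ωx ωxx) {c : ℝ} (hω0 : ∀ x, ω 0 x = -c * Real.sin x)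
include h hω0

/-- **Mean zero is propagated**: `mode ω 0 t = 0` on `[0, T]`. [new here — MODEL] -/
theorem mode_zero_eq_zero {t : ℝ} (ht : t ∈ Icc (0 : ℝ) T) : mode ω 0 t = 0 := by
  have hT : 0 ≤ T := ht.1.trans ht.2
  -- zero derivative on `(0, T)`
  have hd : ∀ s ∈ Ioo (0 : ℝ) T, HasDerivAt (mode ω 0) 0 s := by
    intro s hs
    have hs' : s ∈ Icc (0 : ℝ) T := Ioo_subset_Icc_self hs
    have h1 := hasDerivAt_mode h hs 0
    rw [modeCoeff_slice_t h hs 0, modeCoeff_slice_xx h hs' 0] at h1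
    have hP : modeCoeff (2 * π) 0
        (fun x => ((ω s x : ℝ) : ℂ) * ((hilbertTransformCircle (ω s) x : ℝ) : ℂ)) = 0 := by
      have hS := hasSum_conv_sgn h hs' ((0 : ℕ) : ℤ)
      have h0 := conv_sgn_zero hS
      have hπ : ((2 * π : ℝ) : ℂ) ≠ 0 := by exact_mod_cast (by positivity : (2 * π : ℝ) ≠ 0)
      simpa [I_ne_zero, hπ] using h0
    simpa [hP] using h1
  have hcont : ContinuousOn (mode ω 0) (Icc 0 T) := continuousOn_mode h hT 0
  -- real and imaginary parts are constant
  have hcre : ContinuousOn (fun s => (mode ω 0 s).re) (Icc 0 T) := Complex.continuous_re.comp_continuousOn hcont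
  have hcim : ContinuousOn (fun s => (mode ω 0 s).im) (Icc 0 T) := Complex.continuous_im.comp_continuousOn hcont
  have hre : (mode ω 0 t).re = (mode ω 0 0).re :=
    eq_of_hasDerivAt_zero hcre (fun s hs => by simpa using hasDerivAt_re (hd s hs)) ht
  have him : (mode ω 0 t).im = (mode ω 0 0).im :=
    eq_of_hasDerivAt_zero hcim (fun s hs => by simpa using hasDerivAt_im (hd s hs)) ht
  rw [mode_zero_zero hω0] at hre him
  exact Complex.ext (by simpa using hre) (by simpa using him)

/-- `coef ω 0 t = 0` on `[0, T]`. -/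
theorem coef_zero_eq_zero {t : ℝ} (ht : t ∈ Icc (0 : ℝ) T) : coef ω 0 t = 0 := by
  rw [coef, Nat.cast_zero, mode_zero_eq_zero h hω0 ht, mul_zero]

/-- **The complex cascade**: on `(0, T)`, `d/dt c_k = ½ Σ_{i+j=k} c_i c_j − ν k² c_k`. [new here — MODEL] -/
theorem hasDerivAt_coef {t : ℝ} (ht : t ∈ Ioo (0 : ℝ) T) (k : ℕ) :
    HasDerivAt (coef ω k)
      (((1 / 2 : ℝ) : ℂ) * (∑ p ∈ antidiagonal k, coef ω p.1 t * coef ω p.2 t)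
        - ((ν * (k : ℝ) ^ 2 : ℝ) : ℂ) * coef ω k t) t := by
  have ht' : t ∈ Icc (0 : ℝ) T := Ioo_subset_Icc_self ht
  -- the pairing sum at mode `k`
  set S : ℂ := ∑ j ∈ range (k + 1), mode ω j t * mode ω ((k : ℤ) - j) t with hSdef
  have hS : I * (((2 * π : ℝ) : ℂ) * modeCoeff (2 * π) k
      (fun x => ((ω t x : ℝ) : ℂ) * ((hilbertTransformCircle (ω t) x : ℝ) : ℂ))) = S :=
    conv_sgn_eq_sum_range (a := fun l => mode ω l t) k (mode_zero_eq_zero h hω0 ht') (hasSum_conv_sgn h ht' k)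
  -- the antidiagonal sum of `coef` is `−S/π²`
  have hanti : ∑ p ∈ antidiagonal k, coef ω p.1 t * coef ω p.2 t = -(1 / (π : ℂ) ^ 2) * S := by
    rw [hSdef, Finset.Nat.sum_antidiagonal_eq_sum_range_succ_mk, mul_sum]
    refine sum_congr rfl fun j hj => ?_
    rw [Finset.mem_range] at hj
    simp only [coef]
    rw [Nat.cast_sub (by omega : j ≤ k)]
    have hπ : (π : ℂ) ≠ 0 := by exact_mod_cast Real.pi_ne_zero
    field_simp
    rw [Complex.I_sq]
    ring
  -- derivative of `mode k`, through the equation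
  have h1 := hasDerivAt_mode h ht k
  rw [modeCoeff_slice_t h ht k, modeCoeff_slice_xx h ht' k] at h1
  have h2 := h1.const_mul (-(I / π))
  have hπ : (π : ℂ) ≠ 0 := by exact_mod_cast Real.pi_ne_zero
  have h2π : ((2 * π : ℝ) : ℂ) ≠ 0 := by exact_mod_cast (by positivity : (2 * π : ℝ) ≠ 0)
  -- `P = S / (2π I)`
  have hP : modeCoeff (2 * π) k (fun x => ((ω t x : ℝ) : ℂ) * ((hilbertTransformCircle (ω t) x : ℝ) : ℂ))
      = S / (I * ((2 * π : ℝ) : ℂ)) := by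
    rw [← hS]; field_simp
  refine h2.congr_deriv ?_
  rw [hP, hanti]
  simp only [coef]
  push_cast
  field_simp
  ring

/-- The weighted cascade variable `e^{νk²t} c_k` has derivative `e^{νk²t} · ½ Σ_{i+j=k} c_i c_j` on `(0,T)`. -/
theorem hasDerivAt_weighted_coef {t : ℝ} (ht : t ∈ Ioo (0 : ℝ) T) (k : ℕ) :
    HasDerivAt (fun s => ((Real.exp (ν * (k : ℝ) ^ 2 * s) : ℝ) : ℂ) * coef ω k s)
      (((Real.exp (ν * (k : ℝ) ^ 2 * t) : ℝ) : ℂ) *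
        (((1 / 2 : ℝ) : ℂ) * ∑ p ∈ antidiagonal k, coef ω p.1 t * coef ω p.2 t)) t := by
  have he : HasDerivAt (fun s => ((Real.exp (ν * (k : ℝ) ^ 2 * s) : ℝ) : ℂ))
      (((Real.exp (ν * (k : ℝ) ^ 2 * t) * (ν * (k : ℝ) ^ 2) : ℝ) : ℂ)) t := by
    have h1 : HasDerivAt (fun s => Real.exp (ν * (k : ℝ) ^ 2 * s)) (Real.exp (ν * (k : ℝ) ^ 2 * t) * (ν * (k : ℝ) ^ 2)) t := by
      have := ((hasDerivAt_id t).const_mul (ν * (k : ℝ) ^ 2)).exp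
      simpa using this
    exact h1.ofReal_comp
  refine (he.mul (hasDerivAt_coef h hω0 ht k)).congr_deriv ?_
  push_cast
  ring

/-- **The modes stay «sine»: `Im c_k ≡ 0` on `[0, T]`** (strong induction on the triangular structure). [new here — MODEL] -/
theorem coef_im_eq_zero : ∀ k : ℕ, ∀ t ∈ Icc (0 : ℝ) T, (coef ω k t).im = 0 := by
  intro k
  induction k using Nat.strong_induction_on with
  | _ k ih =>
    intro t ht
    have hT : 0 ≤ T := ht.1.trans ht.2
    set ψ : ℝ → ℂ := fun s => ((Real.exp (ν * (k : ℝ) ^ 2 * s) : ℝ) : ℂ) * coef ω k s with hψ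
    -- `Im ψ` has zero derivative on `(0, T)`
    have hd : ∀ s ∈ Ioo (0 : ℝ) T, HasDerivAt (fun s => (ψ s).im) 0 s := by
      intro s hs
      have hs' : s ∈ Icc (0 : ℝ) T := Ioo_subset_Icc_self hs
      have h1 := hasDerivAt_im (hasDerivAt_weighted_coef h hω0 hs k)
      have hzero : (∑ p ∈ antidiagonal k, coef ω p.1 s * coef ω p.2 s).im = 0 := by
        rw [Complex.im_sum]
        refine sum_eq_zero fun p hp => ?_
        have hsum : p.1 + p.2 = k := mem_antidiagonal.mp hp
        rcases Nat.eq_zero_or_pos p.1 with h0 | h0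
        · rw [h0, coef_zero_eq_zero h hω0 hs', zero_mul, Complex.zero_im]
        rcases Nat.eq_zero_or_pos p.2 with h2 | h2
        · rw [h2, coef_zero_eq_zero h hω0 hs', mul_zero, Complex.zero_im]
        rw [Complex.mul_im, ih p.1 (by omega) s hs', ih p.2 (by omega) s hs']
        ring
      have hval : ((((Real.exp (ν * (k : ℝ) ^ 2 * s) : ℝ) : ℂ) *
          (((1 / 2 : ℝ) : ℂ) * ∑ p ∈ antidiagonal k, coef ω p.1 s * coef ω p.2 s))).im = 0 := by
        rw [Complex.im_ofReal_mul, Complex.im_ofReal_mul, hzero, mul_zero, mul_zero]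
      rw [hval] at h1
      exact h1
    -- continuity of `Im ψ` on `[0, T]`
    have hcont : ContinuousOn (fun s => (ψ s).im) (Icc 0 T) := by
      refine Complex.continuous_im.comp_continuousOn ?_
      refine ((continuous_ofReal.comp (Real.continuous_exp.comp (continuous_const.mul continuous_id))).continuousOn).mul ?_
      exact (continuousOn_mode h hT k).const_smul (-(I / π)) |>.congr fun s _ => by simp [coef, smul_eq_mul]
    have hconst := eq_of_hasDerivAt_zero hcont hd ht
    -- the datum is real
    have hinit : (ψ 0).im = 0 := by
      simp only [hψ, mul_zero, Real.exp_zero, Complex.ofReal_one, one_mul]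
      rcases Nat.lt_or_ge k 2 with hk | hk
      · interval_cases k
        · rw [coef_zero_eq_zero h hω0 ⟨le_rfl, hT⟩, Complex.zero_im]
        · rw [coef_one_zero hω0, Complex.ofReal_im]
      · rw [coef_zero_of_two_le hω0 hk, Complex.zero_im]
    rw [hinit] at hconst
    -- unweight
    have hexp : (0 : ℝ) < Real.exp (ν * (k : ℝ) ^ 2 * t) := Real.exp_pos _
    have : (ψ t).im = Real.exp (ν * (k : ℝ) ^ 2 * t) * (coef ω k t).im := by
      simp only [hψ, Complex.im_ofReal_mul]
    rw [this] at hconst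
    exact (mul_eq_zero.mp hconst).resolve_left hexp.ne'

/-- **The real parts of the cascade variables form a finite-horizon sine cascade** `IsSineCascadeOn ν c T`.
[new here — MODEL] -/
theorem isSineCascadeOn_coef_re (hT : 0 < T) : IsSineCascadeOn ν c T (fun k t => (coef ω k t).re) where
  zero t ht := by simp [coef_zero_eq_zero h hω0 ht]
  cont k := Complex.continuous_re.comp_continuousOn
    (((continuousOn_mode h hT.le k).const_smul (-(I / π))).congr fun s _ => by simp [coef, smul_eq_mul])
  ode k t ht := by
    have ht' : t ∈ Icc (0 : ℝ) T := Ioo_subset_Icc_self ht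
    have h1 := hasDerivAt_re (hasDerivAt_coef h hω0 ht k)
    refine h1.congr_deriv ?_
    rw [Complex.sub_re, Complex.re_ofReal_mul, Complex.re_ofReal_mul, Complex.re_sum]
    congr 2
    refine sum_congr rfl fun p _ => ?_
    rw [Complex.mul_re, coef_im_eq_zero h hω0 p.1 t ht', coef_im_eq_zero h hω0 p.2 t ht']
    ring
  one_init := by rw [coef_one_zero hω0, Complex.ofReal_re]
  init_zero k hk := by rw [coef_zero_of_two_le hω0 hk, Complex.zero_re]

omit hω0 in
/-- Uniform bound on the real cascade variables at a fixed time. -/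
theorem exists_abs_coef_re_le {t : ℝ} (ht : t ∈ Icc (0 : ℝ) T) : ∃ M : ℝ, ∀ k : ℕ, |(coef ω k t).re| ≤ M := by
  obtain ⟨M, hM⟩ := exists_norm_mode_le h ht
  refine ⟨‖-(I / (π : ℂ))‖ * M, fun k => ?_⟩
  calc |(coef ω k t).re| ≤ ‖coef ω k t‖ := Complex.abs_re_le_norm _
    _ = ‖-(I / (π : ℂ))‖ * ‖mode ω k t‖ := by rw [coef, norm_mul]
    _ ≤ ‖-(I / (π : ℂ))‖ * M := by gcongr; exact hM k

/-! ### The theorems -/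

/-- **No classical solution from large sine data survives to `t = log 2/ν`.** For `0 < ν` and `48ν ≤ c`, every
classical `2π`-periodic solution of `ω_t = ω·Hω + ν ω_xx` on `[0, T]` with `ω(0,·) = −c sin` has `T < log 2/ν`:
the real parts of its cascade variables form an `IsSineCascadeOn ν c T`, which for `log 2/ν ≤ T` would be unbounded
in `k` at `t = log 2/ν` (`IsSineCascadeOn.unbounded_of_le` ← `unbounded_of_le`, p498092), against the uniform bound
`2·sup|ω(t,·)|`. [new here — MODEL; the periodic `σ = 2` finite-time singularity,
cite: SilantyevLushnikovSiegelAmbrose2025 §6 p. 25] -/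
theorem horizon_lt_log_two_div (hν : 0 < ν) (hc : 48 * ν ≤ c) : T < Real.log 2 / ν := by
  by_contra hcon
  have hle : Real.log 2 / ν ≤ T := not_lt.mp hcon
  have hlog : 0 < Real.log 2 / ν := div_pos (Real.log_pos (by norm_num)) hν
  have hT : 0 < T := lt_of_lt_of_le hlog hle
  obtain ⟨M, hM⟩ := exists_abs_coef_re_le h (t := Real.log 2 / ν) ⟨hlog.le, hle⟩
  obtain ⟨k, hk⟩ := (isSineCascadeOn_coef_re h hω0 hT).unbounded_of_le hν hc hle M
  exact absurd ((le_abs_self _).trans (hM k)) (not_le.mpr hk)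

/-- **Transfer form.** If every global sine cascade with datum `c` (viscosity `ν`) has coefficients unbounded in `k`
at some time `τ > 0`, then every classical solution from `−c sin x` has horizon `T < τ`. (The certified threshold
constants enter here: e.g. a certificate proving unboundedness at `τ` for all `c > c_up` via `tail_induction`.)
[new here — MODEL] -/
theorem horizon_lt_of_cascade_unbounded {τ : ℝ} (hτ : 0 < τ)
    (hall : ∀ e : ℕ → ℝ → ℝ, IsSineCascade ν c e → ∀ M : ℝ, ∃ k : ℕ, M < e k τ) : T < τ := by
  by_contra hcon
  have hle : τ ≤ T := not_lt.mp hcon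
  have hT : 0 < T := lt_of_lt_of_le hτ hle
  obtain ⟨E, hE, hEe⟩ := (isSineCascadeOn_coef_re h hω0 hT).exists_extend hT
  obtain ⟨M, hM⟩ := exists_abs_coef_re_le h (t := τ) ⟨hτ.le, hle⟩
  obtain ⟨k, hk⟩ := hall E hE M
  rw [hEe k τ ⟨hτ.le, hle⟩] at hk
  exact absurd ((le_abs_self _).trans (hM k)) (not_le.mpr hk)

end cascade

/-! ### Transfer on the explicit cascade (appended) -/

/-- **Transfer form on the explicit cascade.** Since every sine cascade IS `cascadeSolution ν (sineDatum c)` on `t ≥ 0`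
(`IsSineCascade.eq_cascadeSolution`, `SheetNSLineTorusCascadeExistence`), it suffices to certify unboundedness in `k` of the
ONE explicit family at a time `τ > 0`: then every classical solution from `−c sin x` has horizon `T < τ` (this is exactly the
shape of the certified statements — e.g. `∀ M, ∃ k, M < cascadeSolution ν (sineDatum c) k τ` for all `c > c_up ν` from a
`tail_induction`/`unbounded_of_base` certificate). [new here — MODEL] -/
theorem horizon_lt_of_cascadeSolution_unbounded (h : IsClassicalSolution ν T ω ωt ωx ωxx) {c : ℝ}
    (hω0 : ∀ x, ω 0 x = -c * Real.sin x) {τ : ℝ} (hτ : 0 < τ)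
    (hunb : ∀ M : ℝ, ∃ k : ℕ, M < cascadeSolution ν (sineDatum c) k τ) : T < τ :=
  horizon_lt_of_cascade_unbounded h hω0 hτ fun e he M => by
    obtain ⟨k, hk⟩ := hunb M
    exact ⟨k, by rwa [he.eq_cascadeSolution k τ hτ.le]⟩

/-- The `c ≥ 48ν` horizon bound, re-derived through the explicit cascade (consistency check of the two routes). -/
theorem horizon_lt_log_two_div' (h : IsClassicalSolution ν T ω ωt ωx ωxx) {c : ℝ}
    (hω0 : ∀ x, ω 0 x = -c * Real.sin x) (hν : 0 < ν) (hc : 48 * ν ≤ c) : T < Real.log 2 / ν :=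
  horizon_lt_of_cascadeSolution_unbounded h hω0 (div_pos (Real.log_pos (by norm_num)) hν)
    (cascadeSolution_sine_unbounded_of_le hν hc)

end SheetNSLineTorusCascade
end Summit.NavierStokesRegularity.OSWSelfSimilar
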